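import Summits.BirchSwinnertonDyer.BirchSwinnertonDyer.Theorems.PrintCf2RamifiedOffTYZMoverParity
import Summits.BirchSwinnertonDyer.BirchSwinnertonDyer.Theorems.PrintCf2RamifiedOffTYZMoverKerCount
import Literature.LinearAlgebra.Matrix.AdjugateKernelLine
import Literature.NumberTheory.EllipticCurves.CongruentNumberOddMonskySelmerLocal
import HarnessLib

/-!
# Crux `PrintCf2.RamifiedOffTYZOfFacts` (stmt-BirchSwinnertonDyer-20509), line `offtyz-v7`, LEAD cycle 10 (cruxlead-20509 g9):
# THE KERNEL LINE OF `N_d = [[A_d + D₋₂, z_d],[0, 0]]` IN CENSUS COORDINATES (programme F3, linear algebra)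

THEOREMS ONLY (no `def`, no named fact, no `sorry`), `--supports stmt-BirchSwinnertonDyer-20509`.  The block law on a block `d ≡ 6 (mod 8)`
(`MoverAssembly.sqMotion_eq_kerSum_dotProduct_bits_six`, p704973) reads the square class `χ_d(g)` as `Σ_c kerSum(N_d)_c · x_c(g)` with
`N_d = fromBlocks (A_d + D₋₂) (col z_d) 0 0` on `Fin m ⊕ Unit` in the genus regime `#ker N_d = 2`; the identity (★)₆ (`…QFormIdentitySix`)
produces the Cramer determinant `det((A_d + D₋₂)[col x ← t_d])`.  This file is the bridge (crux workfile `Lines/offtyz_v7_SevenSector.md` §10,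
last sentence; instrument `check_kerline.py`, 7057 cases, 0 failures):

* §1 `kerSum_eq_adjugate_col_of_row_zero` (abstract, over `𝔽₂`): for a square matrix `N` with a ZERO row `r₀` and `#ker N = 2`, the kernel
  line is the `r₀`-column of the adjugate: `kerSum N = adj(N)_{· r₀}` (rows of `adj N` are left null vectors, the left kernel is `{0, e_{r₀}}`
  by `rank N = rank Nᵀ`, so every other column of `adj N` vanishes, and `adj N ≠ 0` for a line kernel — tree `adjugate_ne_zero_of_vecMul_line`).
* §2 `adjugate_fromBlocks_col_inl_inr` / `…_inr_inr`: for `N = [[B, c],[0, 0]]`, `adj(N)_{(inl x)(inr)} = det(B[col x ← c])` (a column swap)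
  and `adj(N)_{(inr)(inr)} = det B`.
* §3 **`kerSum_inl_add_kerSum_inr_eq_det_updateCol`**: if `#ker N = 2` and `B·𝟙 = t + c`, then for every `x`,
  `kerSum(N)_{inl x} + kerSum(N)_{inr} = det(B[col x ← t])` (`det(B[x ← c]) + det B = det(B[x ← c]) + det(B[x ← B𝟙]) = det(B[x ← t])`).
  For Monsky's data `B = A_d + D₋₂`, `c = z_d = ((2/q)₊)`, `t = ((−1/q)₊)`: `B·𝟙 = ((−2/q)₊) = t + c` (§4, `kerSum_six_inl_add_inr`).
Pure linear algebra over `𝔽₂`; BSD is not proved by any of this; no class is closed by this file.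

References: [cite: HornJohnson2013, §0.8.2 (adjugate; rank one for corank one)]; [cite: Stevenhagen1995RedeiMatrices, §2 (Rédei matrices and
4-ranks: the kernel line)]; [cite: HeathBrown1994SelmerCongruentII, Appendix (Monsky), typescript p. 41 L20–L36]; crux notes `Lines/offtyz_v7_SevenSector.md` §9–§10.
-/

noncomputable section

open scoped Classical

open Finset Matrix Literature.NumberTheory.EllipticCurves.HeathBrown1994 Literature.NumberTheory.EllipticCurves.HeathBrown1994.Families
  Summit.BirchSwinnertonDyer.PrintCf2.QForm

set_option autoImplicit false

namespace Summit.BirchSwinnertonDyer.PrintCf2.MoverAssembly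

/-! ## §1 The kernel line of a matrix with a zero row is a column of the adjugate -/

section KernelLine

variable {ι : Type*} [Fintype ι] [DecidableEq ι]

/-- `#ker Nᵀ = #ker N` over `𝔽₂` (`rank Nᵀ = rank N`). [cite: HornJohnson2013, §0.4.6 (rank equalities)] -/
theorem card_ker_transpose (N : Matrix ι ι (ZMod 2)) :
    Fintype.card {v : ι → ZMod 2 // Nᵀ *ᵥ v = 0} = Fintype.card {v : ι → ZMod 2 // N *ᵥ v = 0} := by
  rw [card_ker_mulVec_eq_pow, card_ker_mulVec_eq_pow, rank_transpose]

/-- **The kernel line of a matrix with a zero row is the corresponding column of the adjugate.**  If `N` has the zero row `r₀` and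
`#ker N = 2`, then `kerSum N = (adj N)_{· r₀}`: the left kernel is the line `{0, e_{r₀}}`, every row of `adj N` lies in it, so the columns
`≠ r₀` of `adj N` vanish; `adj N ≠ 0` (line kernel), so the column `r₀` is the non-zero kernel vector. [cite: HornJohnson2013, §0.8.2] -/
theorem kerSum_eq_adjugate_col_of_row_zero (N : Matrix ι ι (ZMod 2)) {r₀ : ι} (hrow : ∀ j, N r₀ j = 0)
    (hcard : Fintype.card {v : ι → ZMod 2 // N *ᵥ v = 0} = 2) : kerSum N = fun r => N.adjugate r r₀ := by
  obtain ⟨hne, hker⟩ := ker_iff_of_card_eq_two N hcard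
  have hdet : N.det = 0 := det_eq_zero_of_row_eq_zero r₀ hrow
  -- the left kernel is the line `{0, e_{r₀}}`
  have hcardT : Fintype.card {v : ι → ZMod 2 // Nᵀ *ᵥ v = 0} = 2 := by rw [card_ker_transpose, hcard]
  obtain ⟨hneT, hkerT⟩ := ker_iff_of_card_eq_two Nᵀ hcardT
  have he : Nᵀ *ᵥ (Pi.single r₀ (1 : ZMod 2)) = 0 := by
    rw [mulVec_transpose]; funext j; rw [Pi.zero_apply, single_one_vecMul]; exact hrow j
  have he0 : (Pi.single r₀ (1 : ZMod 2) : ι → ZMod 2) ≠ 0 := fun h => by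
    have := congrFun h r₀; simp at this
  have hline : kerSum Nᵀ = Pi.single r₀ 1 := by
    rcases (hkerT _).mp he with h | h
    · exact absurd h he0
    · exact h.symm
  have hleft : ∀ x : ι → ZMod 2, x ᵥ* N = 0 → x = 0 ∨ x = Pi.single r₀ 1 := by
    intro x hx
    rw [← hline]
    exact (hkerT x).mp (by rw [mulVec_transpose]; exact hx)
  -- `adj N ≠ 0`
  have hadj : N.adjugate ≠ 0 := by
    refine Literature.LinearAlgebra.Matrix.adjugate_ne_zero_of_vecMul_line N (Pi.single r₀ 1) (fun x hx => ?_) r₀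
    rcases hleft x hx with h | h
    · exact ⟨0, by rw [h, zero_smul]⟩
    · exact ⟨1, by rw [h, one_smul]⟩
  -- every column `j ≠ r₀` of `adj N` vanishes
  have hcol0 : ∀ r j, j ≠ r₀ → N.adjugate r j = 0 := by
    intro r j hj
    rcases hleft _ (Literature.LinearAlgebra.Matrix.adjugate_row_vecMul N hdet r) with h | h
    · exact congrFun h j
    · have := congrFun h j
      rw [Pi.single_eq_of_ne hj] at this
      exact this
  -- so the column `r₀` is non-zero, and it is a kernel vector
  have hcolne : (fun r => N.adjugate r r₀) ≠ 0 := by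
    intro h0
    apply hadj
    ext r j
    by_cases hj : j = r₀
    · subst hj; exact congrFun h0 r
    · exact hcol0 r j hj
  rcases (hker _).mp (Literature.LinearAlgebra.Matrix.mulVec_adjugate_col N hdet r₀) with h | h
  · exact absurd h hcolne
  · exact h.symm

end KernelLine

/-! ## §2 The adjugate column of `[[B, c],[0, 0]]` -/

section Blocks

variable {m : ℕ}

/-- The lower-right corner cofactor: `adj([[B, c],[0, 0]])_{(inr)(inr)} = det B`. [cite: HornJohnson2013, §0.8.2] -/
theorem adjugate_fromBlocks_col_inr_inr (B : Matrix (Fin m) (Fin m) (ZMod 2)) (c : Fin m → ZMod 2) :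
    (fromBlocks B (Matrix.of fun j (_ : Unit) => c j) (0 : Matrix Unit (Fin m) (ZMod 2)) (0 : Matrix Unit Unit (ZMod 2))).adjugate
        (Sum.inr ()) (Sum.inr ()) = B.det := by
  rw [adjugate_apply]
  have h : (fromBlocks B (Matrix.of fun j (_ : Unit) => c j) (0 : Matrix Unit (Fin m) (ZMod 2)) (0 : Matrix Unit Unit (ZMod 2))).updateRow
      (Sum.inr ()) (Pi.single (Sum.inr ()) 1) =
      fromBlocks B (Matrix.of fun j (_ : Unit) => c j) (0 : Matrix Unit (Fin m) (ZMod 2)) (1 : Matrix Unit Unit (ZMod 2)) := by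
    ext (i | i) (j | j)
    · rw [updateRow_ne (Sum.inl_ne_inr), fromBlocks_apply₁₁, fromBlocks_apply₁₁]
    · rw [updateRow_ne (Sum.inl_ne_inr), fromBlocks_apply₁₂, fromBlocks_apply₁₂]
    · rw [Subsingleton.elim i (), updateRow_self, fromBlocks_apply₂₁, Pi.single_eq_of_ne Sum.inl_ne_inr, Matrix.zero_apply]
    · rw [Subsingleton.elim i (), Subsingleton.elim j (), updateRow_self, fromBlocks_apply₂₂, Pi.single_eq_same, Matrix.one_apply_eq]
  rw [h, det_fromBlocks_zero₂₁, det_one, mul_one]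

/-- **`adj([[B, c],[0, 0]])_{(inl x)(inr)} = det(B[col x ← c])`**: replace the zero row by `e_{inl x}` and exchange the columns `inl x`, `inr`
(a block-triangular matrix `[[B[x ← c], B_{·x}],[0, 1]]`; signs are `1` in `𝔽₂`). [cite: HornJohnson2013, §0.8.2] -/
theorem adjugate_fromBlocks_col_inl_inr (B : Matrix (Fin m) (Fin m) (ZMod 2)) (c : Fin m → ZMod 2) (x : Fin m) :
    (fromBlocks B (Matrix.of fun j (_ : Unit) => c j) (0 : Matrix Unit (Fin m) (ZMod 2)) (0 : Matrix Unit Unit (ZMod 2))).adjugate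
        (Sum.inl x) (Sum.inr ()) = (B.updateCol x c).det := by
  set N := fromBlocks B (Matrix.of fun j (_ : Unit) => c j) (0 : Matrix Unit (Fin m) (ZMod 2)) (0 : Matrix Unit Unit (ZMod 2)) with hN
  rw [adjugate_apply]
  set N₁ := N.updateRow (Sum.inr ()) (Pi.single (Sum.inl x) 1) with hN₁
  -- exchange the columns `inl x` and `inr ()`
  have hσ : (N₁.submatrix id (Equiv.swap (Sum.inl x) (Sum.inr ()))).det = N₁.det := by
    rw [det_permute', Equiv.Perm.sign_swap (Sum.inl_ne_inr)]
    have h1 : ((-1 : ℤˣ) : ZMod 2) = 1 := by decide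
    rw [h1, one_mul]
  have hblock : N₁.submatrix id (Equiv.swap (Sum.inl x) (Sum.inr ())) =
      fromBlocks (B.updateCol x c) (Matrix.of fun j (_ : Unit) => B j x) (0 : Matrix Unit (Fin m) (ZMod 2)) (1 : Matrix Unit Unit (ZMod 2)) := by
    ext (i | i) (j | j)
    · rw [submatrix_apply, id, fromBlocks_apply₁₁, updateCol_apply]
      by_cases hj : j = x
      · subst hj
        rw [Equiv.swap_apply_left, hN₁, updateRow_ne Sum.inl_ne_inr, hN, fromBlocks_apply₁₂, Matrix.of_apply, if_pos rfl]
      · rw [Equiv.swap_apply_of_ne_of_ne (fun h => hj (Sum.inl_injective h)) Sum.inl_ne_inr, hN₁, updateRow_ne Sum.inl_ne_inr, hN,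
          fromBlocks_apply₁₁, if_neg hj]
    · rw [submatrix_apply, id, Subsingleton.elim j (), Equiv.swap_apply_right, hN₁, updateRow_ne Sum.inl_ne_inr, hN, fromBlocks_apply₁₁,
        fromBlocks_apply₁₂, Matrix.of_apply]
    · rw [submatrix_apply, id, Subsingleton.elim i (), fromBlocks_apply₂₁, Matrix.zero_apply, hN₁, updateRow_self]
      by_cases hj : j = x
      · subst hj; rw [Equiv.swap_apply_left, Pi.single_eq_of_ne (Ne.symm Sum.inl_ne_inr)]
      · rw [Equiv.swap_apply_of_ne_of_ne (fun h => hj (Sum.inl_injective h)) Sum.inl_ne_inr,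
          Pi.single_eq_of_ne (fun h => hj (Sum.inl_injective h))]
    · rw [submatrix_apply, id, Subsingleton.elim i (), Subsingleton.elim j (), Equiv.swap_apply_right, hN₁, updateRow_self, Pi.single_eq_same,
        fromBlocks_apply₂₂, Matrix.one_apply_eq]
  rw [← hσ, hblock, det_fromBlocks_zero₂₁, det_one, mul_one]

/-- `det(B[col x ← B·v]) = det B · v_x` (Cramer's rule `adj(B)·(B v) = det B · v`). [cite: HornJohnson2013, §0.8.2 (Cramer's rule)] -/
theorem det_updateCol_mulVec (B : Matrix (Fin m) (Fin m) (ZMod 2)) (v : Fin m → ZMod 2) (x : Fin m) :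
    (B.updateCol x (B *ᵥ v)).det = B.det * v x := by
  rw [← cramer_apply, cramer_eq_adjugate_mulVec, mulVec_mulVec, adjugate_mul, Matrix.smul_mulVec, one_mulVec, Pi.smul_apply, smul_eq_mul]

/-! ## §3 The kernel line in census coordinates -/

/-- **THE KERNEL LINE IN CENSUS COORDINATES.**  For `N = [[B, c],[0, 0]]` on `Fin m ⊕ Unit` over `𝔽₂` with `#ker N = 2` and `B·𝟙 = t + c`:
`kerSum(N)_{inl x} + kerSum(N)_{inr} = det(B[col x ← t])` for every `x`
(`= adj(N)_{(inl x)(inr)} + adj(N)_{(inr)(inr)} = det(B[x ← c]) + det B = det(B[x ← c]) + det(B[x ← B𝟙]) = det(B[x ← t])`).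
[cite: HornJohnson2013, §0.8.2] [cite: Stevenhagen1995RedeiMatrices, §2] -/
theorem kerSum_inl_add_kerSum_inr_eq_det_updateCol (B : Matrix (Fin m) (Fin m) (ZMod 2)) (c t : Fin m → ZMod 2)
    (hB1 : B *ᵥ (fun _ => (1 : ZMod 2)) = fun j => t j + c j)
    (hcard : Fintype.card {v : Fin m ⊕ Unit → ZMod 2 //
      (fromBlocks B (Matrix.of fun j (_ : Unit) => c j) (0 : Matrix Unit (Fin m) (ZMod 2)) (0 : Matrix Unit Unit (ZMod 2))) *ᵥ v = 0} = 2)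
    (x : Fin m) :
    kerSum (fromBlocks B (Matrix.of fun j (_ : Unit) => c j) (0 : Matrix Unit (Fin m) (ZMod 2)) (0 : Matrix Unit Unit (ZMod 2))) (Sum.inl x) +
      kerSum (fromBlocks B (Matrix.of fun j (_ : Unit) => c j) (0 : Matrix Unit (Fin m) (ZMod 2)) (0 : Matrix Unit Unit (ZMod 2))) (Sum.inr ()) =
        (B.updateCol x t).det := by
  have hrow : ∀ j, (fromBlocks B (Matrix.of fun j (_ : Unit) => c j) (0 : Matrix Unit (Fin m) (ZMod 2)) (0 : Matrix Unit Unit (ZMod 2)))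
      (Sum.inr ()) j = 0 := by
    rintro (j | j)
    · rw [fromBlocks_apply₂₁, Matrix.zero_apply]
    · rw [fromBlocks_apply₂₂, Matrix.zero_apply]
  rw [kerSum_eq_adjugate_col_of_row_zero _ hrow hcard]
  dsimp only
  rw [adjugate_fromBlocks_col_inl_inr, adjugate_fromBlocks_col_inr_inr]
  -- `det B = det(B[x ← B𝟙]) = det(B[x ← t]) + det(B[x ← c])`
  have h1 : B.det = (B.updateCol x (fun j => t j + c j)).det := by
    rw [← hB1, det_updateCol_mulVec, mul_one]
  rw [h1, show (fun j => t j + c j) = t + c from rfl, det_updateCol_add]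
  have e : ∀ u v : ZMod 2, u + (v + u) = v := by decide
  exact e _ _

/-! ## §4 Monsky's data: `(A_d + D₋₂)·𝟙 = ((−1/q)₊) + ((2/q)₊)` -/

variable (q : Fin m → ℕ) (hq : ∀ j, (q j).Prime) (hqodd : ∀ j, Odd (q j))

include hq hqodd in
/-- **Row sums of `A_d + D₋₂`**: the rows of Monsky's `A` sum to zero, so `(A_d + D₋₂)·𝟙 = ((−2/q_j)₊)_j = ((−1/q_j)₊ + (2/q_j)₊)_j`.
[cite: HeathBrown1994SelmerCongruentII, Appendix (Monsky), typescript p. 39 L13–L26] [cite: IrelandRosen1990, Ch. 5 §1 Prop. 5.1.2] -/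
theorem legendreMatrix_add_diagonal_mulVec_one :
    (legendreMatrix q + legendreDiagonal q (-2)) *ᵥ (fun _ => (1 : ZMod 2)) = fun j => addLegendreSym (-1) (q j) + addLegendreSym 2 (q j) := by
  funext j
  rw [add_mulVec, Pi.add_apply, mulVec, mulVec, dotProduct, dotProduct]
  simp only [mul_one]
  rw [← Finset.add_sum_erase _ _ (mem_univ j), legendreMatrix_apply_self,
    Finset.sum_congr rfl (fun l hl => legendreMatrix_apply_of_ne q (ne_of_mem_erase hl).symm), CharTwo.add_self_eq_zero, zero_add,
    legendreDiagonal, ← Finset.add_sum_erase _ _ (mem_univ j), diagonal_apply_eq,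
    Finset.sum_eq_zero (fun l hl => diagonal_apply_ne _ (ne_of_mem_erase hl).symm), add_zero,
    Literature.NumberTheory.EllipticCurves.CongruentNumberOddMonskySelmer.addLegendreSym_neg_two (hq j)
      (Literature.NumberTheory.EllipticCurves.Smith2016.ne_two_of_odd q hqodd j)]

include hq hqodd in
/-- **THE KERNEL LINE OF `N_d` READ BY THE KUMMER BITS `e_{q_x} + e_2`.**  For a block tuple `q` (distinct odd primes) with
`N_d = [[A_d + D₋₂, z_d],[0, 0]]` in the genus regime `#ker N_d = 2`: `kerSum(N_d)_{inl x} + kerSum(N_d)_{inr} = det((A_d + D₋₂)[col x ← t_d])`,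
`t_d = ((−1/q_j)₊)_j` — the Cramer determinant of (★)₆. [cite: HeathBrown1994SelmerCongruentII, Appendix (Monsky), typescript p. 41 L20–L36]
[cite: Stevenhagen1995RedeiMatrices, §2] -/
theorem kerSum_six_inl_add_inr
    (hcard : Fintype.card {v : Fin m ⊕ Unit → ZMod 2 //
      (fromBlocks (legendreMatrix q + legendreDiagonal q (-2)) (Matrix.of fun j (_ : Unit) => addLegendreSym 2 (q j))
        (0 : Matrix Unit (Fin m) (ZMod 2)) (0 : Matrix Unit Unit (ZMod 2))) *ᵥ v = 0} = 2)
    (x : Fin m) :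
    kerSum (fromBlocks (legendreMatrix q + legendreDiagonal q (-2)) (Matrix.of fun j (_ : Unit) => addLegendreSym 2 (q j))
        (0 : Matrix Unit (Fin m) (ZMod 2)) (0 : Matrix Unit Unit (ZMod 2))) (Sum.inl x) +
      kerSum (fromBlocks (legendreMatrix q + legendreDiagonal q (-2)) (Matrix.of fun j (_ : Unit) => addLegendreSym 2 (q j))
        (0 : Matrix Unit (Fin m) (ZMod 2)) (0 : Matrix Unit Unit (ZMod 2))) (Sum.inr ()) =
      ((legendreMatrix q + legendreDiagonal q (-2)).updateCol x (fun j => addLegendreSym (-1) (q j))).det :=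
  kerSum_inl_add_kerSum_inr_eq_det_updateCol _ _ _ (legendreMatrix_add_diagonal_mulVec_one q hq hqodd) hcard x

end Blocks

end Summit.BirchSwinnertonDyer.PrintCf2.MoverAssembly

end
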